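import Literature.NumberTheory.PAdicHodge.TateTwistPeriodLine
import HarnessLib

/-!
# Alternating `ℤ_p`-bilinear forms on the rank-two Tate module are proportional: the Legendre relation `Δ = c · ι∘e_∞` from two values

Topic `Literature/NumberTheory/PAdicHodge`; THEOREMS ONLY (no definition, no named fact, no instance, no `sorry`). Bookkeeping for the
hypothesis `hLeg : Pω(S)Pη(T) − Pη(S)Pω(T) = ι(e_∞(S,T))` of `TatePairingCochainLegendre` / `RecognitionFromTeichLog`: on a free
`ℤ_p`-module of rank `2` with basis `(b₀, b₁)`, an alternating biadditive `ℤ_p`-homogeneous form `f` with values in a ring `B ⊇ ℤ_p` is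
`f(S,T) = det_b(S,T) · f(b₀,b₁)` (§1, `alternating_eq_det_mul`); hence TWO such forms `Δ` (the period determinant
`Pω(S)Pη(T) − Pη(S)Pω(T)`) and `G = ι ∘ e_∞` (the Weil pairing read on the period line) with `Δ(b₀,b₁) = ι_F(c₁) · t` (the tree's
`BdRPeriodDeterminantOfWeil.exists_det_eq_algebraMap_mul_tFrac`) and `G(b₀,b₁) = a₀ · t`, `a₀ ∈ ℤ_p ∖ 0` (non-degeneracy), satisfy
**`Δ = ι_F(c₁ a₀⁻¹) · G`** (§2, ★ `exists_legendre_of_basis_values`) — the Legendre relation with a constant of `F^×`, which the line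
absorbs into `Pη`. [Colmez: the genuine constant is `±1`; the tree's abstract Weil tower only fixes it in `F^×`.]

Line `kato_lever` of crux K★ `stmt-BirchSwinnertonDyer-22226`; BSD / K★ / [REC] are NOT proved by any of this.

## References
* P. Colmez, *Périodes p-adiques des variétés abéliennes*, Math. Ann. 292 (1992), §2 (`∫ω∫η′ − ∫η∫ω′ = 2iπ`). [Colmez1992PeriodesAbeliennes]
* J.-M. Fontaine, Invent. Math. 65 (1982), §5 (the period pairing and `Λ² T_p`). [Fontaine1982FormesDifferentielles]
* J. H. Silverman, *AEC* (2009), III §7–8 (`T_ℓ E ≅ ℤ_ℓ²`, the Weil pairing is alternating). [SilvermanAEC2009]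
-/

noncomputable section

open Field Function ValuativeRel WittVector

namespace Literature.NumberTheory.PAdicHodge

open Literature.NumberTheory.GaloisRepresentations
open Literature.NumberTheory.GaloisRepresentations.IsNonarchimedeanLocalField
open Literature.NumberTheory.GaloisCohomology

/-! ## §1 Alternating `ℤ_p`-homogeneous biadditive forms on a rank-two free module -/

section Alternating

variable {R : Type*} [CommRing R] {T : Type*} [AddCommGroup T] [Module R T] {B : Type*} [CommRing B] (s : R →+* B)

/-- An alternating biadditive form is antisymmetric: `f y x = − f x y`. [cite: SilvermanAEC2009, III §8 (e alternating)] -/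
theorem alternating_antisymm (f : T →+ T →+ B) (halt : ∀ x, f x x = 0) (x y : T) : f y x = -f x y := by
  have h := halt (x + y)
  simp only [map_add, AddMonoidHom.add_apply, halt, zero_add, add_zero] at h
  linear_combination h

/-- ★ **`f(S,U) = det_b(S,U) · f(b₀,b₁)`**: a biadditive form `f : T × T → B`, `R`-homogeneous in both variables through `s : R → B`
and alternating, on a module with basis `(b₀, b₁)` indexed by `Fin 2`, is the determinant times its value on the basis.
[cite: Fontaine1982FormesDifferentielles, §5] [cite: SilvermanAEC2009, III §7–8] -/
theorem alternating_eq_det_mul (b : Module.Basis (Fin 2) R T) (f : T →+ T →+ B)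
    (hl : ∀ (c : R) (x y : T), f (c • x) y = s c * f x y) (hr : ∀ (c : R) (x y : T), f x (c • y) = s c * f x y)
    (halt : ∀ x, f x x = 0) (S U : T) :
    f S U = s (b.repr S 0 * b.repr U 1 - b.repr S 1 * b.repr U 0) * f (b 0) (b 1) := by
  have hS : S = b.repr S 0 • b 0 + b.repr S 1 • b 1 := by
    conv_lhs => rw [← b.sum_repr S]
    rw [Fin.sum_univ_two]
  have hU : U = b.repr U 0 • b 0 + b.repr U 1 • b 1 := by
    conv_lhs => rw [← b.sum_repr U]
    rw [Fin.sum_univ_two]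
  have h10 : f (b 1) (b 0) = -f (b 0) (b 1) := alternating_antisymm f halt _ _
  conv_lhs => rw [hS, hU]
  simp only [map_add, AddMonoidHom.add_apply, hl, hr, halt, h10, map_sub, map_mul]
  ring

end Alternating

/-! ## §2 The Legendre relation up to `F^×` from two values on a basis -/

namespace BdRPlusTop

variable {F : Type} [Field F] [ValuativeRel F] [TopologicalSpace F] [IsNonarchimedeanLocalField F] [CharZero F]
  {p : ℕ} [Fact p.Prime] [Fact (¬ IsUnit (p : integerC F))] [IsAdicComplete (Ideal.span {(p : integerC F)}) (integerC F)]
  (hp : valuation F p < 1) (hF : Function.Surjective (fontaineTheta (integerC F) p))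

/-- `ι : ℤ_p → B_dR⁺(F)` through `F`: `of (qpToBdR a) = of (embBdRHom (ι_F a))` for the canonical `ℚ_p → F`.
[cite: FontaineAsterisque223III, Exp. II §1.5] -/
theorem of_qpToBdR_eq_of_embBdRHom (a : ℚ_[p]) :
    of F p (qpToBdR a) = of F p (embBdRHom hp hF (LocalField.padicRingHom F p hp a)) := by
  rw [show LocalField.padicRingHom F p hp a = algebraMap (PadicBase F p hp) F ((PadicBase.toPadic hp).symm a) from rfl,
    embBdRHom_algebraMap, RingEquiv.apply_symm_apply]

/-- ★ **The Legendre relation up to a constant of `F^×` from two values.** Let `T` be a `ℤ_p`-module with basis `(b₀, b₁)` and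
`Δ, G : T × T → B_dR⁺(F)` biadditive, `ℤ_p`-homogeneous and alternating, with `Δ(b₀,b₁) = ι_F(c₁) · t` and `G(b₀,b₁) = a₀ · t`,
`a₀ ∈ ℤ_p ∖ 0`. Then **`Δ(S,U) = ι_F(c₁ · (ι a₀)⁻¹) · G(S,U)` for all `S, U`** (and `c₁ (ι a₀)⁻¹ ≠ 0` iff `c₁ ≠ 0`). For `Δ` the period
determinant `Pω(S)Pη(U) − Pη(S)Pω(U)` and `G = ι ∘ e_∞` this is the Legendre relation of the line with its `F^×`-constant.
[cite: Colmez1992PeriodesAbeliennes, §2] [cite: Fontaine1982FormesDifferentielles, §5] -/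
theorem exists_legendre_of_basis_values {T : Type*} [AddCommGroup T] [Module ℤ_[p] T] (b : Module.Basis (Fin 2) ℤ_[p] T)
    (Δ G : T →+ T →+ BdRPlusTop F p)
    (hΔl : ∀ (c : ℤ_[p]) (x y : T), Δ (c • x) y = of F p (qpToBdR (c : ℚ_[p])) * Δ x y)
    (hΔr : ∀ (c : ℤ_[p]) (x y : T), Δ x (c • y) = of F p (qpToBdR (c : ℚ_[p])) * Δ x y) (hΔalt : ∀ x, Δ x x = 0)
    (hGl : ∀ (c : ℤ_[p]) (x y : T), G (c • x) y = of F p (qpToBdR (c : ℚ_[p])) * G x y)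
    (hGr : ∀ (c : ℤ_[p]) (x y : T), G x (c • y) = of F p (qpToBdR (c : ℚ_[p])) * G x y) (hGalt : ∀ x, G x x = 0)
    {c₁ : F} (hΔb : Δ (b 0) (b 1) = of F p (embBdRHom hp hF c₁) * of F p tBdR)
    {a₀ : ℤ_[p]} (ha₀ : a₀ ≠ 0) (hGb : G (b 0) (b 1) = of F p (qpToBdR (a₀ : ℚ_[p])) * of F p tBdR) :
    ∀ S U : T, Δ S U = of F p (embBdRHom hp hF (c₁ * (LocalField.padicRingHom F p hp (a₀ : ℚ_[p]))⁻¹)) * G S U := by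
  intro S U
  let s : ℤ_[p] →+* BdRPlusTop F p := ((of F p).toRingHom.comp (qpToBdR (F := F) (p := p))).comp (PadicInt.Coe.ringHom (p := p))
  have hs : ∀ c : ℤ_[p], s c = of F p (qpToBdR (c : ℚ_[p])) := fun c => rfl
  have hΔ := alternating_eq_det_mul s b Δ (fun c x y => by rw [hs]; exact hΔl c x y) (fun c x y => by rw [hs]; exact hΔr c x y) hΔalt S U
  have hG := alternating_eq_det_mul s b G (fun c x y => by rw [hs]; exact hGl c x y) (fun c x y => by rw [hs]; exact hGr c x y) hGalt S U
  have ha₀F : LocalField.padicRingHom F p hp (a₀ : ℚ_[p]) ≠ 0 :=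
    (map_ne_zero_iff _ (LocalField.padicRingHom F p hp).injective).2 (PadicInt.coe_ne_zero.2 ha₀)
  have hinv : of F p (embBdRHom hp hF (c₁ * (LocalField.padicRingHom F p hp (a₀ : ℚ_[p]))⁻¹)) * of F p (qpToBdR (a₀ : ℚ_[p])) =
      of F p (embBdRHom hp hF c₁) := by
    rw [of_qpToBdR_eq_of_embBdRHom hp hF, ← map_mul, ← map_mul, inv_mul_cancel_right₀ ha₀F]
  rw [hΔ, hG, hs, hΔb, hGb, ← hinv]
  ring

end BdRPlusTop

end Literature.NumberTheory.PAdicHodge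

end
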